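import Summits.BirchSwinnertonDyer.BirchSwinnertonDyer.Theorems.AdditiveKolyvaginRoadLocalDictionaries
import Summits.BirchSwinnertonDyer.BirchSwinnertonDyer.Theorems.AdditiveKolyvaginRoadKolyvaginRelaxedStab
import Summits.BirchSwinnertonDyer.BirchSwinnertonDyer.Theorems.KolyvaginRoadThreeZhangSupplySignedOfJump
import Summits.BirchSwinnertonDyer.BirchSwinnertonDyer.Theorems.KolyvaginRoadThreeMethod2RankLowering
import HarnessLib

/-!
# Route `AdditiveKolyvaginRoad`, crux `KolyvaginPrimitiveAdditive` (item stmt-BirchSwinnertonDyer-20132), stub LOC,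
# towards (Supply) at a general prime `p` — the SIGNED supply from (J), (Stab), (IsoBound)
# (p-generic port of koly3b's `…ZhangSupplySignedOfJumpGood` + `…ZhangSupplySignedAssembled`, `3 ↦ p` odd,
# ordinary ↦ TORIC, unipotent-admissible ↦ Bertolini–Darmon admissible (`AdmQ`), `GoodLevel` dropped)
# (cell `pub/bsd-wall`, lead prover `bsd-wall-akr-p1` g4; `--supports stmt-BirchSwinnertonDyer-20132`, helper)

WHAT. §1 `supply_signed_of_jumpP`: W. Zhang's Lemma 8.2 for the level structure, SIGNED, from the unsigned jump — for
every non-empty admissible level `n`, Kolyvagin `ℓ ∉ T`, sign `s`, a NON-ZERO `s`-eigenclass of complex conjugation in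
the relaxed group `G(n, ℓ, T)` (Kummer at `∞` and at the finite `v ≠ λ` off `plK(T)` above no prime of `n`, TORIC above
`n`, TRANSVERSE on `plK(T)`, free at `λ = plK ℓ`). Inputs: the localisations `loc` (`hloc`), local forms `b` with (REC)
`hrec` and the isotropies `hisoKum` ∕ `hisoTor` (toric, above admissible primes only) ∕ `hisoTr`; `c² = 1`; (Stab)
`hstab`; (J) `hjump`; (IsoBound) `hbound`. Proof VERBATIM koly3b's: eigen-decomposition in the `c`-stable `G` (`p` odd,
`exists_eigen_decomposition`), isotropy of `loc_λ(G)` by (REC), and the additive-group lemma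
`exists_eigen_not_mem_of_jump`. §2 `supply_signed_of_jump_boundP`: the same with (Stab) DISCHARGED by akr-p1 g3's
`conjAct_mem_relaxedGroupP` (p549756; place currency ↔ `plK` currency by the uniqueness of the place above an inert
prime) and `c² = 1` from `#Aut(K/ℚ) = 2`.

HONEST FRAMING: theorems only; 0 definitions, 0 named facts, 0 `sorry`; CONDITIONAL on (J) and (IsoBound); closes
nothing.

References: [cite: WZhang2014, §8.1, Lemma 8.2] [cite: McCallumLMS1991, Prop. 2.1 (p. 296), Lemma 5.3 (p. 303)]
[cite: GrossLMS1991, §5 (5.1), Prop. 8.1] [cite: MilneADT2006, Ch. I, Thm. 4.10] [cite: BertoliniDarmon2005, §2.2–§2.3].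
-/

-- single-conjunct summit: `Summit.BirchSwinnertonDyer.BirchSwinnertonDyer.…` repeats the name by design
set_option linter.dupNamespace false

noncomputable section

open scoped Classical

namespace Summit.BirchSwinnertonDyer.BirchSwinnertonDyer.Theorems.AdditiveKoly

open WeierstrassCurve NumberField IsDedekindDomain
  Literature.NumberTheory.EllipticCurves Literature.NumberTheory.EllipticCurves.ModularForms
  Literature.NumberTheory.GaloisRepresentations Module
open Summit.BirchSwinnertonDyer.Rank1Residual.X11b.Three.Koly.Method2
open Summit.BirchSwinnertonDyer.Rank1Residual.X11b.Three.Koly.ZhangSupply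

variable (W : WeierstrassCurve ℚ) (K : Type) [Field K] [NumberField K] (p : ℕ)
variable [W.IsGloballyMinimal] [Fact p.Prime] (ι : K →+* ℂ) (c : K ≃ₐ[ℚ] K)
  [Module (ZMod p) (Vp W K p)]
  [∀ v : Place K, Module (ZMod p)
    (galoisCohomology (((W.baseChange K).torsionGaloisModule ((p ^ 1 : ℕ) : ℤ)).toLocal v) 1)]

/-! ## §1 The signed supply from (J), (Stab), (IsoBound) -/

/-- **W. Zhang's Lemma 8.2 for the level structure, SIGNED, from the unsigned jump** (general odd `p`, toric level
conditions). Data: the genuine localisations `loc` (`hloc`), the places `plK` of the Kolyvagin primes, bilinear local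
forms `b` with (REC) `hrec` and the isotropies `hisoKum` ∕ `hisoTor` (above Bertolini–Darmon admissible primes) ∕
`hisoTr`, complex conjugation `c` with `c² = 1`; hypotheses (Stab) `hstab`, (J) `hjump`, (IsoBound) `hbound` for every
non-empty level `n`, Kolyvagin `ℓ ∉ T`. CONCLUSION: for each sign a NON-ZERO class of that sign in `G(n, ℓ, T)`.
[cite: WZhang2014, Lemma 8.2] [cite: McCallumLMS1991, Prop. 2.1, Lemma 5.3] [cite: GrossLMS1991, Prop. 8.1] -/
theorem supply_signed_of_jumpP (hp2 : p ≠ 2) (hc2 : c * c = 1)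
    (loc : (v : Place K) → Vp W K p →ₗ[ZMod p]
      galoisCohomology (((W.baseChange K).torsionGaloisModule ((p ^ 1 : ℕ) : ℤ)).toLocal v) 1)
    (hloc : ∀ (v : Place K) (x : Vp W K p),
      loc v x = galoisCohomology.localization ((W.baseChange K).torsionGaloisModule ((p ^ 1 : ℕ) : ℤ)) v 1 x)
    (plK : {ℓ // Zhang2014.IsKolyvaginPrime (W.conductorNorm ℤ) W K p ℓ} → HeightOneSpectrum (𝓞 K))
    (b : (v : Place K) →
      galoisCohomology (((W.baseChange K).torsionGaloisModule ((p ^ 1 : ℕ) : ℤ)).toLocal v) 1 →ₗ[ZMod p]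
      galoisCohomology (((W.baseChange K).torsionGaloisModule ((p ^ 1 : ℕ) : ℤ)).toLocal v) 1 →ₗ[ZMod p] ZMod p)
    (hrec : ∀ (x y : Vp W K p) (T : Finset (Place K)), (∀ v, v ∉ T → b v (loc v x) (loc v y) = 0) →
      ∑ v ∈ T, b v (loc v x) (loc v y) = 0)
    (hisoKum : ∀ (v : Place K),
      ∀ x ∈ (W.baseChange K).kummerLocalConditionAt ((p ^ 1 : ℕ) : ℤ) (Place.Completion v),
      ∀ y ∈ (W.baseChange K).kummerLocalConditionAt ((p ^ 1 : ℕ) : ℤ) (Place.Completion v), b v x y = 0)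
    (hisoTor : ∀ (q : AdmQ W K p) (v : HeightOneSpectrum (𝓞 K)), ((q : ℕ) : 𝓞 K) ∈ v.asIdeal →
      ∀ (x y : Vp W K p),
      x ∈ toricLocalKer (W.baseChange K) (v.adicCompletion K) ((p ^ 1 : ℕ) : ℤ) →
      y ∈ toricLocalKer (W.baseChange K) (v.adicCompletion K) ((p ^ 1 : ℕ) : ℤ) →
      b (Sum.inr v) (loc (Sum.inr v) x) (loc (Sum.inr v) y) = 0)
    (hisoTr : ∀ (ℓ : {ℓ // Zhang2014.IsKolyvaginPrime (W.conductorNorm ℤ) W K p ℓ}) (x y : Vp W K p),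
      x ∈ transverseLocalKerP W K p ι ℓ (plK ℓ) → y ∈ transverseLocalKerP W K p ι ℓ (plK ℓ) →
      b (Sum.inr (plK ℓ)) (loc (Sum.inr (plK ℓ)) x) (loc (Sum.inr (plK ℓ)) y) = 0)
    (hstab : ∀ (n : Finset (AdmQ W K p)), n.Nonempty →
      ∀ (ℓ : {ℓ // Zhang2014.IsKolyvaginPrime (W.conductorNorm ℤ) W K p ℓ}) (T : Finset _), ℓ ∉ T →
      ∀ x : Vp W K p,
        ((∀ w : InfinitePlace K, x ∈ selmerLocalKer (W.baseChange K) w.Completion ((p ^ 1 : ℕ) : ℤ)) ∧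
          (∀ v : HeightOneSpectrum (𝓞 K), v ≠ plK ℓ → (∀ ℓ' ∈ T, plK ℓ' ≠ v) →
            ((∀ q ∈ n, ((q : ℕ) : 𝓞 K) ∉ v.asIdeal) →
              x ∈ selmerLocalKer (W.baseChange K) (v.adicCompletion K) ((p ^ 1 : ℕ) : ℤ)) ∧
            (∀ q ∈ n, ((q : ℕ) : 𝓞 K) ∈ v.asIdeal →
              x ∈ toricLocalKer (W.baseChange K) (v.adicCompletion K) ((p ^ 1 : ℕ) : ℤ))) ∧
          (∀ ℓ' ∈ T, x ∈ transverseLocalKerP W K p ι ℓ' (plK ℓ'))) →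
        ((∀ w : InfinitePlace K,
            conjAct W c ((p ^ 1 : ℕ) : ℤ) x ∈ selmerLocalKer (W.baseChange K) w.Completion ((p ^ 1 : ℕ) : ℤ)) ∧
          (∀ v : HeightOneSpectrum (𝓞 K), v ≠ plK ℓ → (∀ ℓ' ∈ T, plK ℓ' ≠ v) →
            ((∀ q ∈ n, ((q : ℕ) : 𝓞 K) ∉ v.asIdeal) →
              conjAct W c ((p ^ 1 : ℕ) : ℤ) x ∈
                selmerLocalKer (W.baseChange K) (v.adicCompletion K) ((p ^ 1 : ℕ) : ℤ)) ∧
            (∀ q ∈ n, ((q : ℕ) : 𝓞 K) ∈ v.asIdeal →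
              conjAct W c ((p ^ 1 : ℕ) : ℤ) x ∈
                toricLocalKer (W.baseChange K) (v.adicCompletion K) ((p ^ 1 : ℕ) : ℤ))) ∧
          (∀ ℓ' ∈ T, conjAct W c ((p ^ 1 : ℕ) : ℤ) x ∈ transverseLocalKerP W K p ι ℓ' (plK ℓ'))))
    (hjump : ∀ (n : Finset (AdmQ W K p)), n.Nonempty →
      ∀ (ℓ : {ℓ // Zhang2014.IsKolyvaginPrime (W.conductorNorm ℤ) W K p ℓ}) (T : Finset _), ℓ ∉ T →
      ∀ x₀ : Vp W K p, ∃ x : Vp W K p,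
        ((∀ w : InfinitePlace K, x ∈ selmerLocalKer (W.baseChange K) w.Completion ((p ^ 1 : ℕ) : ℤ)) ∧
          (∀ v : HeightOneSpectrum (𝓞 K), v ≠ plK ℓ → (∀ ℓ' ∈ T, plK ℓ' ≠ v) →
            ((∀ q ∈ n, ((q : ℕ) : 𝓞 K) ∉ v.asIdeal) →
              x ∈ selmerLocalKer (W.baseChange K) (v.adicCompletion K) ((p ^ 1 : ℕ) : ℤ)) ∧
            (∀ q ∈ n, ((q : ℕ) : 𝓞 K) ∈ v.asIdeal →
              x ∈ toricLocalKer (W.baseChange K) (v.adicCompletion K) ((p ^ 1 : ℕ) : ℤ))) ∧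
          (∀ ℓ' ∈ T, x ∈ transverseLocalKerP W K p ι ℓ' (plK ℓ'))) ∧
        ∀ a : ℤ, x - a • x₀ ∉ (W.baseChange K).torsionLocalKer ((plK ℓ).adicCompletion K) ((p ^ 1 : ℕ) : ℤ))
    (hbound : ∀ (ℓ : {ℓ // Zhang2014.IsKolyvaginPrime (W.conductorNorm ℤ) W K p ℓ}) (s : Bool) (x y : Vp W K p),
      conjAct W c ((p ^ 1 : ℕ) : ℤ) x = sgnP s • x → conjAct W c ((p ^ 1 : ℕ) : ℤ) y = sgnP s • y →
      b (Sum.inr (plK ℓ)) (loc (Sum.inr (plK ℓ)) x) (loc (Sum.inr (plK ℓ)) x) = 0 →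
      b (Sum.inr (plK ℓ)) (loc (Sum.inr (plK ℓ)) x) (loc (Sum.inr (plK ℓ)) y) = 0 →
      b (Sum.inr (plK ℓ)) (loc (Sum.inr (plK ℓ)) y) (loc (Sum.inr (plK ℓ)) x) = 0 →
      b (Sum.inr (plK ℓ)) (loc (Sum.inr (plK ℓ)) y) (loc (Sum.inr (plK ℓ)) y) = 0 →
      x ∉ (W.baseChange K).torsionLocalKer ((plK ℓ).adicCompletion K) ((p ^ 1 : ℕ) : ℤ) →
      ∃ a : ℤ, y - a • x ∈ (W.baseChange K).torsionLocalKer ((plK ℓ).adicCompletion K) ((p ^ 1 : ℕ) : ℤ)) :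
    ∀ (n : Finset (AdmQ W K p)), n.Nonempty →
      ∀ (ℓ : {ℓ // Zhang2014.IsKolyvaginPrime (W.conductorNorm ℤ) W K p ℓ}) (T : Finset _), ℓ ∉ T →
      ∀ s : Bool, ∃ x : Vp W K p, conjAct W c ((p ^ 1 : ℕ) : ℤ) x = sgnP s • x ∧ x ≠ 0 ∧
        (∀ w : InfinitePlace K, x ∈ selmerLocalKer (W.baseChange K) w.Completion ((p ^ 1 : ℕ) : ℤ)) ∧
        (∀ v : HeightOneSpectrum (𝓞 K), v ≠ plK ℓ → (∀ ℓ' ∈ T, plK ℓ' ≠ v) →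
          ((∀ q ∈ n, ((q : ℕ) : 𝓞 K) ∉ v.asIdeal) →
            x ∈ selmerLocalKer (W.baseChange K) (v.adicCompletion K) ((p ^ 1 : ℕ) : ℤ)) ∧
          (∀ q ∈ n, ((q : ℕ) : 𝓞 K) ∈ v.asIdeal →
            x ∈ toricLocalKer (W.baseChange K) (v.adicCompletion K) ((p ^ 1 : ℕ) : ℤ))) ∧
        (∀ ℓ' ∈ T, x ∈ transverseLocalKerP W K p ι ℓ' (plK ℓ')) := by
  intro n hn ℓ T hℓT s
  have hp : p.Prime := Fact.out
  -- the relaxed group `G = G(n, ℓ, T)` as a subgroup of `H¹(K, E[p])`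
  let G : AddSubgroup (Vp W K p) :=
    { carrier := {x | (∀ w : InfinitePlace K, x ∈ selmerLocalKer (W.baseChange K) w.Completion ((p ^ 1 : ℕ) : ℤ)) ∧
        (∀ v : HeightOneSpectrum (𝓞 K), v ≠ plK ℓ → (∀ ℓ' ∈ T, plK ℓ' ≠ v) →
          ((∀ q ∈ n, ((q : ℕ) : 𝓞 K) ∉ v.asIdeal) →
            x ∈ selmerLocalKer (W.baseChange K) (v.adicCompletion K) ((p ^ 1 : ℕ) : ℤ)) ∧
          (∀ q ∈ n, ((q : ℕ) : 𝓞 K) ∈ v.asIdeal →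
            x ∈ toricLocalKer (W.baseChange K) (v.adicCompletion K) ((p ^ 1 : ℕ) : ℤ))) ∧
        (∀ ℓ' ∈ T, x ∈ transverseLocalKerP W K p ι ℓ' (plK ℓ'))}
      add_mem' := fun {x y} hx hy ↦
        ⟨fun w ↦ add_mem (hx.1 w) (hy.1 w),
          fun v hv hvT ↦ ⟨fun hq ↦ add_mem ((hx.2.1 v hv hvT).1 hq) ((hy.2.1 v hv hvT).1 hq),
            fun q hq hqv ↦ add_mem ((hx.2.1 v hv hvT).2 q hq hqv) ((hy.2.1 v hv hvT).2 q hq hqv)⟩,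
          fun ℓ' hℓ' ↦ add_mem (hx.2.2 ℓ' hℓ') (hy.2.2 ℓ' hℓ')⟩
      zero_mem' :=
        ⟨fun w ↦ zero_mem _, fun v _ _ ↦ ⟨fun _ ↦ zero_mem _, fun _ _ _ ↦ zero_mem _⟩, fun _ _ ↦ zero_mem _⟩
      neg_mem' := fun {x} hx ↦
        ⟨fun w ↦ neg_mem (hx.1 w),
          fun v hv hvT ↦ ⟨fun hq ↦ neg_mem ((hx.2.1 v hv hvT).1 hq),
            fun q hq hqv ↦ neg_mem ((hx.2.1 v hv hvT).2 q hq hqv)⟩,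
          fun ℓ' hℓ' ↦ neg_mem (hx.2.2 ℓ' hℓ')⟩ }
  set Z := (W.baseChange K).torsionLocalKer ((plK ℓ).adicCompletion K) ((p ^ 1 : ℕ) : ℤ) with hZdef
  have hKumFin : ∀ (v : HeightOneSpectrum (𝓞 K)) (x : Vp W K p),
      x ∈ selmerLocalKer (W.baseChange K) (v.adicCompletion K) ((p ^ 1 : ℕ) : ℤ) →
        loc (Sum.inr v) x ∈
          (W.baseChange K).kummerLocalConditionAt ((p ^ 1 : ℕ) : ℤ) (Place.Completion (Sum.inr v : Place K)) := by
    intro v x hx; rw [hloc]; exact (mem_selmerLocalKer_iff_localization_mem_kummer_P W K p v x).mp hx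
  have hKumInf : ∀ (w : InfinitePlace K) (x : Vp W K p),
      x ∈ selmerLocalKer (W.baseChange K) w.Completion ((p ^ 1 : ℕ) : ℤ) →
        loc (Sum.inl w) x ∈
          (W.baseChange K).kummerLocalConditionAt ((p ^ 1 : ℕ) : ℤ) (Place.Completion (Sum.inl w : Place K)) := by
    intro w x hx; rw [hloc]; exact (mem_selmerLocalKer_iff_localization_mem_kummer_inf_P W K p w x).mp hx
  -- (orth): `loc_λ(G)` is isotropic — reciprocity with all terms off `λ` vanishing
  have horth : ∀ x y : Vp W K p, x ∈ G → y ∈ G →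
      b (Sum.inr (plK ℓ)) (loc (Sum.inr (plK ℓ)) x) (loc (Sum.inr (plK ℓ)) y) = 0 := by
    intro x y hx hy
    have h := hrec x y {(Sum.inr (plK ℓ) : Place K)} fun v hv ↦ ?_
    · rwa [Finset.sum_singleton] at h
    have hv' : v ≠ Sum.inr (plK ℓ) := fun h ↦ hv (Finset.mem_singleton.mpr h)
    rcases v with w | v
    · exact hisoKum (Sum.inl w) _ (hKumInf w x (hx.1 w)) _ (hKumInf w y (hy.1 w))
    · have hvℓ : v ≠ plK ℓ := fun h ↦ hv' (by rw [h])
      by_cases hvT : ∃ ℓ' ∈ T, plK ℓ' = v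
      · obtain ⟨ℓ', hℓ'T, rfl⟩ := hvT
        exact hisoTr ℓ' x y (hx.2.2 ℓ' hℓ'T) (hy.2.2 ℓ' hℓ'T)
      · push Not at hvT
        by_cases hq : ∃ q ∈ n, ((q : ℕ) : 𝓞 K) ∈ v.asIdeal
        · obtain ⟨q, hq, hqv⟩ := hq
          exact hisoTor q v hqv x y ((hx.2.1 v hvℓ hvT).2 q hq hqv) ((hy.2.1 v hvℓ hvT).2 q hq hqv)
        · push Not at hq
          exact hisoKum (Sum.inr v) _ (hKumFin v x ((hx.2.1 v hvℓ hvT).1 hq)) _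
            (hKumFin v y ((hy.2.1 v hvℓ hvT).1 hq))
  -- (dec): eigen-decomposition inside the `conjAct`-stable subgroup `G` (`p` odd, `c² = 1`)
  have hpV : ∀ a : Vp W K p, p • a = 0 := fun a ↦ by
    rw [← Nat.cast_smul_eq_nsmul (ZMod p), ZMod.natCast_self, zero_smul]
  have hτ : ∀ a : Vp W K p, conjAct W c ((p ^ 1 : ℕ) : ℤ) (conjAct W c ((p ^ 1 : ℕ) : ℤ) a) = a :=
    fun a ↦ conjAct_conjAct_of_mul_self W hc2 _ a
  have hG : ∀ a ∈ G, conjAct W c ((p ^ 1 : ℕ) : ℤ) a ∈ G := fun a ha ↦ hstab n hn ℓ T hℓT a ha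
  have hsgn : sgnP s = 1 ∨ sgnP s = -1 := by cases s <;> simp [sgnP]
  have hsgn' : sgnP (!s) = -sgnP s := by cases s <;> rfl
  have hdec : ∀ x, x ∈ G → ∃ y z, y ∈ G ∧ conjAct W c ((p ^ 1 : ℕ) : ℤ) y = sgnP s • y ∧ z ∈ G ∧
      conjAct W c ((p ^ 1 : ℕ) : ℤ) z = sgnP (!s) • z ∧ x = y + z := by
    intro x hx
    obtain ⟨y, hy, z, hz, hyτ, hzτ, hxyz⟩ :=
      exists_eigen_decomposition (n := p) (hp.odd_of_ne_two hp2) hpV (conjAct W c ((p ^ 1 : ℕ) : ℤ)) hτ hsgn G hG hx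
    exact ⟨y, z, hy, hyτ, hz, by rw [hsgn']; exact hzτ, hxyz⟩
  obtain ⟨x, hxG, hxE, hxZ⟩ := exists_eigen_not_mem_of_jump Z (· ∈ G)
    (fun s' x ↦ conjAct W c ((p ^ 1 : ℕ) : ℤ) x = sgnP s' • x)
    (fun x y ↦ b (Sum.inr (plK ℓ)) (loc (Sum.inr (plK ℓ)) x) (loc (Sum.inr (plK ℓ)) y) = 0) s hdec horth
    (fun x₀ ↦ hjump n hn ℓ T hℓT x₀) (fun x y hx hy ↦ hbound ℓ (!s) x y hx hy)
  exact ⟨x, hxE, fun h0 ↦ hxZ (h0 ▸ zero_mem Z), hxG.1, hxG.2.1, hxG.2.2⟩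

/-! ## §2 (Stab) discharged: the signed supply from (J) and (IsoBound) alone -/

omit [Fact p.Prime] [Module (ZMod p) (Vp W K p)]
  [∀ v : Place K, Module (ZMod p)
    (galoisCohomology (((W.baseChange K).torsionGaloisModule ((p ^ 1 : ℕ) : ℤ)).toLocal v) 1)] in
/-- Currency: at the places of the Kolyvagin primes, «`v ≠ plK ℓ`» is «`ℓ ∉ v`» (the place above an inert prime is
unique). [folklore] -/
theorem ne_plK_iff_not_mem
    (plK : {ℓ // Zhang2014.IsKolyvaginPrime (W.conductorNorm ℤ) W K p ℓ} → HeightOneSpectrum (𝓞 K))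
    (hplK : ∀ ℓ, ((ℓ : ℕ) : 𝓞 K) ∈ (plK ℓ).asIdeal)
    (ℓ : {ℓ // Zhang2014.IsKolyvaginPrime (W.conductorNorm ℤ) W K p ℓ}) (v : HeightOneSpectrum (𝓞 K)) :
    v ≠ plK ℓ ↔ ((ℓ : ℕ) : 𝓞 K) ∉ v.asIdeal := by
  refine ⟨fun hv h ↦ hv (placesAbove_eq_of_isPrime_span K ℓ.2.2.2.2.2.1 ℓ.2.1.ne_zero (hplK ℓ) h), fun hv h ↦ ?_⟩
  exact hv (h ▸ hplK ℓ)

/-- **The signed supply from (J) and (IsoBound) alone**, with (Stab) discharged by akr-p1 g3's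
`conjAct_mem_relaxedGroupP` (place currency ↔ `plK` currency by `ne_plK_iff_not_mem`) and `c² = 1` from
`#Aut(K/ℚ) = 2`. Binder shapes as in `supply_signed_of_jumpP`, with `hstab` and `c * c = 1` replaced by
`IsImaginaryQuadratic K`, `c ≠ 1` and the places `hplK`. [cite: WZhang2014, Lemma 8.2] [cite: McCallumLMS1991, Prop. 2.1,
Lemma 5.3] [cite: GrossLMS1991, §5 (5.1), Prop. 8.1] -/
theorem supply_signed_of_jump_boundP (hK : IsImaginaryQuadratic K) (hp2 : p ≠ 2) (hc : c ≠ 1)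
    (loc : (v : Place K) → Vp W K p →ₗ[ZMod p]
      galoisCohomology (((W.baseChange K).torsionGaloisModule ((p ^ 1 : ℕ) : ℤ)).toLocal v) 1)
    (hloc : ∀ (v : Place K) (x : Vp W K p),
      loc v x = galoisCohomology.localization ((W.baseChange K).torsionGaloisModule ((p ^ 1 : ℕ) : ℤ)) v 1 x)
    (plK : {ℓ // Zhang2014.IsKolyvaginPrime (W.conductorNorm ℤ) W K p ℓ} → HeightOneSpectrum (𝓞 K))
    (hplK : ∀ ℓ, ((ℓ : ℕ) : 𝓞 K) ∈ (plK ℓ).asIdeal)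
    (b : (v : Place K) →
      galoisCohomology (((W.baseChange K).torsionGaloisModule ((p ^ 1 : ℕ) : ℤ)).toLocal v) 1 →ₗ[ZMod p]
      galoisCohomology (((W.baseChange K).torsionGaloisModule ((p ^ 1 : ℕ) : ℤ)).toLocal v) 1 →ₗ[ZMod p] ZMod p)
    (hrec : ∀ (x y : Vp W K p) (T : Finset (Place K)), (∀ v, v ∉ T → b v (loc v x) (loc v y) = 0) →
      ∑ v ∈ T, b v (loc v x) (loc v y) = 0)
    (hisoKum : ∀ (v : Place K),
      ∀ x ∈ (W.baseChange K).kummerLocalConditionAt ((p ^ 1 : ℕ) : ℤ) (Place.Completion v),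
      ∀ y ∈ (W.baseChange K).kummerLocalConditionAt ((p ^ 1 : ℕ) : ℤ) (Place.Completion v), b v x y = 0)
    (hisoTor : ∀ (q : AdmQ W K p) (v : HeightOneSpectrum (𝓞 K)), ((q : ℕ) : 𝓞 K) ∈ v.asIdeal →
      ∀ (x y : Vp W K p),
      x ∈ toricLocalKer (W.baseChange K) (v.adicCompletion K) ((p ^ 1 : ℕ) : ℤ) →
      y ∈ toricLocalKer (W.baseChange K) (v.adicCompletion K) ((p ^ 1 : ℕ) : ℤ) →
      b (Sum.inr v) (loc (Sum.inr v) x) (loc (Sum.inr v) y) = 0)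
    (hisoTr : ∀ (ℓ : {ℓ // Zhang2014.IsKolyvaginPrime (W.conductorNorm ℤ) W K p ℓ}) (x y : Vp W K p),
      x ∈ transverseLocalKerP W K p ι ℓ (plK ℓ) → y ∈ transverseLocalKerP W K p ι ℓ (plK ℓ) →
      b (Sum.inr (plK ℓ)) (loc (Sum.inr (plK ℓ)) x) (loc (Sum.inr (plK ℓ)) y) = 0)
    (hjump : ∀ (n : Finset (AdmQ W K p)), n.Nonempty →
      ∀ (ℓ : {ℓ // Zhang2014.IsKolyvaginPrime (W.conductorNorm ℤ) W K p ℓ}) (T : Finset _), ℓ ∉ T →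
      ∀ x₀ : Vp W K p, ∃ x : Vp W K p,
        ((∀ w : InfinitePlace K, x ∈ selmerLocalKer (W.baseChange K) w.Completion ((p ^ 1 : ℕ) : ℤ)) ∧
          (∀ v : HeightOneSpectrum (𝓞 K), v ≠ plK ℓ → (∀ ℓ' ∈ T, plK ℓ' ≠ v) →
            ((∀ q ∈ n, ((q : ℕ) : 𝓞 K) ∉ v.asIdeal) →
              x ∈ selmerLocalKer (W.baseChange K) (v.adicCompletion K) ((p ^ 1 : ℕ) : ℤ)) ∧
            (∀ q ∈ n, ((q : ℕ) : 𝓞 K) ∈ v.asIdeal →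
              x ∈ toricLocalKer (W.baseChange K) (v.adicCompletion K) ((p ^ 1 : ℕ) : ℤ))) ∧
          (∀ ℓ' ∈ T, x ∈ transverseLocalKerP W K p ι ℓ' (plK ℓ'))) ∧
        ∀ a : ℤ, x - a • x₀ ∉ (W.baseChange K).torsionLocalKer ((plK ℓ).adicCompletion K) ((p ^ 1 : ℕ) : ℤ))
    (hbound : ∀ (ℓ : {ℓ // Zhang2014.IsKolyvaginPrime (W.conductorNorm ℤ) W K p ℓ}) (s : Bool) (x y : Vp W K p),
      conjAct W c ((p ^ 1 : ℕ) : ℤ) x = sgnP s • x → conjAct W c ((p ^ 1 : ℕ) : ℤ) y = sgnP s • y →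
      b (Sum.inr (plK ℓ)) (loc (Sum.inr (plK ℓ)) x) (loc (Sum.inr (plK ℓ)) x) = 0 →
      b (Sum.inr (plK ℓ)) (loc (Sum.inr (plK ℓ)) x) (loc (Sum.inr (plK ℓ)) y) = 0 →
      b (Sum.inr (plK ℓ)) (loc (Sum.inr (plK ℓ)) y) (loc (Sum.inr (plK ℓ)) x) = 0 →
      b (Sum.inr (plK ℓ)) (loc (Sum.inr (plK ℓ)) y) (loc (Sum.inr (plK ℓ)) y) = 0 →
      x ∉ (W.baseChange K).torsionLocalKer ((plK ℓ).adicCompletion K) ((p ^ 1 : ℕ) : ℤ) →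
      ∃ a : ℤ, y - a • x ∈ (W.baseChange K).torsionLocalKer ((plK ℓ).adicCompletion K) ((p ^ 1 : ℕ) : ℤ)) :
    ∀ (n : Finset (AdmQ W K p)), n.Nonempty →
      ∀ (ℓ : {ℓ // Zhang2014.IsKolyvaginPrime (W.conductorNorm ℤ) W K p ℓ}) (T : Finset _), ℓ ∉ T →
      ∀ s : Bool, ∃ x : Vp W K p, conjAct W c ((p ^ 1 : ℕ) : ℤ) x = sgnP s • x ∧ x ≠ 0 ∧
        (∀ w : InfinitePlace K, x ∈ selmerLocalKer (W.baseChange K) w.Completion ((p ^ 1 : ℕ) : ℤ)) ∧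
        (∀ v : HeightOneSpectrum (𝓞 K), v ≠ plK ℓ → (∀ ℓ' ∈ T, plK ℓ' ≠ v) →
          ((∀ q ∈ n, ((q : ℕ) : 𝓞 K) ∉ v.asIdeal) →
            x ∈ selmerLocalKer (W.baseChange K) (v.adicCompletion K) ((p ^ 1 : ℕ) : ℤ)) ∧
          (∀ q ∈ n, ((q : ℕ) : 𝓞 K) ∈ v.asIdeal →
            x ∈ toricLocalKer (W.baseChange K) (v.adicCompletion K) ((p ^ 1 : ℕ) : ℤ))) ∧
        (∀ ℓ' ∈ T, x ∈ transverseLocalKerP W K p ι ℓ' (plK ℓ')) := by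
  -- `c² = 1` in the two-element group `Aut(K/ℚ)`
  have hc2 : c * c = 1 := by
    haveI : Algebra.IsQuadraticExtension ℚ K := ⟨hK.1⟩
    have hcard : Nat.card (K ≃ₐ[ℚ] K) = 2 := by rw [IsGalois.card_aut_eq_finrank, hK.1]
    obtain ⟨y, -, hy⟩ := (Nat.card_eq_two_iff' (1 : K ≃ₐ[ℚ] K)).mp hcard
    by_contra h
    have h1 : c * c = y := hy _ h
    have h2 : c = y := hy _ hc
    rw [← h2] at h1
    exact hc (mul_left_cancel (h1.trans (mul_one c).symm))
  have hcur := ne_plK_iff_not_mem W K p plK hplK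
  refine supply_signed_of_jumpP W K p ι c hp2 hc2 loc hloc plK b hrec hisoKum hisoTor hisoTr ?_ hjump hbound
  -- (Stab) in `plK` currency from the place-currency theorem
  intro n _ ℓ T _ x hx
  have hx' : (∀ w : InfinitePlace K, x ∈ selmerLocalKer (W.baseChange K) w.Completion ((p ^ 1 : ℕ) : ℤ)) ∧
      (∀ v : HeightOneSpectrum (𝓞 K), ((ℓ : ℕ) : 𝓞 K) ∉ v.asIdeal →
        (∀ ℓ' ∈ T, ((ℓ' : ℕ) : 𝓞 K) ∉ v.asIdeal) →
        ((∀ q ∈ n, ((q : ℕ) : 𝓞 K) ∉ v.asIdeal) →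
          x ∈ selmerLocalKer (W.baseChange K) (v.adicCompletion K) ((p ^ 1 : ℕ) : ℤ)) ∧
        (∀ q ∈ n, ((q : ℕ) : 𝓞 K) ∈ v.asIdeal →
          x ∈ toricLocalKer (W.baseChange K) (v.adicCompletion K) ((p ^ 1 : ℕ) : ℤ))) ∧
      (∀ ℓ' ∈ T, ∀ v : HeightOneSpectrum (𝓞 K), ((ℓ' : ℕ) : 𝓞 K) ∈ v.asIdeal →
        x ∈ transverseLocalKerP W K p ι ℓ' v) := by
    refine ⟨hx.1, fun v hv hvT ↦ hx.2.1 v ((hcur ℓ v).mpr hv) (fun ℓ' hℓ' ↦ ((hcur ℓ' v).mpr (hvT ℓ' hℓ')).symm),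
      fun ℓ' hℓ' v hv ↦ ?_⟩
    have hveq : v = plK ℓ' := by
      by_contra hne
      exact (hcur ℓ' v).mp hne hv
    rw [hveq]
    exact hx.2.2 ℓ' hℓ'
  have h := conjAct_mem_relaxedGroupP W p hK hc ι n ℓ T x hx'
  exact ⟨h.1, fun v hv hvT ↦ h.2.1 v ((hcur ℓ v).mp hv) (fun ℓ' hℓ' ↦ (hcur ℓ' v).mp (hvT ℓ' hℓ').symm),
    fun ℓ' hℓ' ↦ h.2.2 ℓ' hℓ' (plK ℓ') (hplK ℓ')⟩

end Summit.BirchSwinnertonDyer.BirchSwinnertonDyer.Theorems.AdditiveKoly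

end
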